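import Literature.NumberTheory.Transcendental.ZilberClassAxioms
import Literature.ModelTheory.Quasiminimal.ClassCategoricity
import HarnessLib

/-!
# The class of closed E-subfields of Zilber fields, and Zilber's categoricity theorem from
`ℵ₀`-homogeneity alone

B. Zilber, *Pseudo-exponentiation on algebraically closed fields of characteristic zero*, Ann.
Pure Appl. Logic 132 (2005), Thm 1.1; M. Bays, J. Kirby, Algebra & Number Theory 12 (2018),
Thm 9.1, Def. 6.3 ("let `𝒦(M)` be the smallest class of `L`-structures which contains `M` and
all its closed substructures and is closed under isomorphism …") and proof of Thm 8.2; J. Kirby,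
J. Symbolic Logic 75 (2010), Def. 1.1 (axiom I.2: "if `H ∈ 𝒞` and `X ⊆ H` then `cl_H(X) ∈ 𝒞`")
and Lemma 1.3; L. Haykazyan, J. Symbolic Logic 81 (2016), Def. 2 and Prop. 4.

`ZilberCategoricity.lean` / `ZilberClassAxioms.lean` present Zilber fields as the class
`ZilberClass` of `Language.eclIso`-structures and reduce Zilber's categoricity theorem to
Haykazyan's class axioms for it; with the abstract half now proved (`ClassCategoricity.lean`),
`ZilberCategoricityReduction.lean` leaves four hypotheses, one of which (`h₃`: `ecl`-closed
E-subfields of Zilber fields are Zilber fields, i.e. satisfy strong exponential-algebraic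
closedness) is only used to know that closed subsets are again members. The categoricity proof
never needs the closed subsets to satisfy Zilber's axioms — only to be `ℵ₀`-homogeneous, which
they inherit. This file therefore replaces `ZilberClass` by the class used in the sources:

* `ZilberClosedClass` — exponential fields `H` (in `Type`, with their canonical
  `Language.eclIso`-structure and `cl = ecl`) admitting an embedding of exponential rings into a
  Zilber field with `ecl`-closed image ("closed substructures of models", Bays–Kirby Def. 6.3;
  Kirby's axiom I.2 holds by construction);
* the transfer of quantifier-free `Language.eclIso`-types and of `ecl` along closed embeddings
  (`image_ecl_of_closedEmb`, `relMap_comp_iff_of_closedEmb`, `eqQFType₂_comp_iff_of_closedEmb`;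
  Kirby 2010, Lemma 1.3, Haykazyan Prop. 4);
* `ZilberClosedClass.isQuasiminimalPregeometryClass_of` — Haykazyan's Def. 2 for this class from
  THREE hypotheses about Zilber fields `K, K'` (in `Type`): `h₂` the `ecl(∅)`'s are isomorphic
  (Kirby 2013 FPEF, Cor. 6.10), and `h₄₃`, `h₄₄` the two clauses of `ℵ₀`-homogeneity over countable
  `ecl`-closed subsets across two Zilber fields (Bays–Kirby 2013, Prop. 5; Bays–Kirby 2018,
  Thm 6.9, QM4–QM5) — all other clauses are proved;
* `zilber_categoricity_of_homogeneity` — **Zilber's categoricity theorem from `h₂`, `h₄₃`, `h₄₄`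
  alone** (the abstract half is `IsQuasiminimalPregeometryClass.nonempty_equiv_of_mk_eq'`).

No named fact is introduced.

## References

* B. Zilber, Ann. Pure Appl. Logic 132 (2005) 67–95: Thm 1.1.
* M. Bays, J. Kirby, Algebra & Number Theory 12 (2018) 493–549: Def. 6.3, Thm 8.2 (proof),
  Thm 9.1.
* M. Bays, J. Kirby, arXiv:1305.0493 (2013): Props 4–5.
* J. Kirby, J. Symbolic Logic 75 (2010): Def. 1.1, Lemma 1.3, Thm 3.3.
* L. Haykazyan, J. Symbolic Logic 81 (2016): Def. 2, Prop. 4, Thm 16.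
-/

noncomputable section

open Set Cardinal
open FirstOrder FirstOrder.Language
open Literature.ModelTheory.ExponentialFields Literature.ModelTheory.Quasiminimal

namespace Literature.NumberTheory.Transcendental

/-! ### Closed embeddings of exponential fields -/

section ClosedEmb

variable {R : Type*} [Field R] [ExponentialRing R] {K : Type*} [Field K] [ExponentialRing K]

/-- **An embedding of exponential rings with `ecl`-closed image co-restricts to an isomorphism
onto the E-subfield `ecl(range φ) = range φ`.** [folklore] -/
def equivRangeOfClosedEmb (φ : ExponentialRingHom R K) (hφ : ecl (Set.range φ) = Set.range φ) :
    ExponentialRingEquiv R (Khovanskii.eclSubfield (Set.range φ)) :=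
  have hmem : ∀ z : R, φ z ∈ Khovanskii.eclSubfield (Set.range φ) := fun z => by
    change φ z ∈ ecl (Set.range φ)
    rw [hφ]; exact ⟨z, rfl⟩
  have hbij : Function.Bijective (φ.toRingHom.codRestrict (Khovanskii.eclSubfield (Set.range φ)) hmem) := by
    refine ⟨fun z w h => φ.toRingHom.injective (congr_arg Subtype.val h :), fun w => ?_⟩
    have hw : (w : K) ∈ ecl (Set.range φ) := w.2
    rw [hφ] at hw
    obtain ⟨z, hz⟩ := hw
    exact ⟨z, Subtype.ext hz⟩
  { RingEquiv.ofBijective (φ.toRingHom.codRestrict (Khovanskii.eclSubfield (Set.range φ)) hmem) hbij with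
    map_exp' := fun z => Subtype.ext (by
      change (φ (ExponentialRing.exp z) : K) = ExponentialRing.exp (φ z : K)
      exact φ.map_exp z) }

/-- `equivRangeOfClosedEmb` is `φ` on coordinates. [folklore] -/
@[simp] theorem coe_equivRangeOfClosedEmb_apply (φ : ExponentialRingHom R K)
    (hφ : ecl (Set.range φ) = Set.range φ) (z : R) :
    ((equivRangeOfClosedEmb φ hφ z : Khovanskii.eclSubfield (Set.range φ)) : K) = φ z := rfl

/-- **Closed embeddings carry `ecl` onto `ecl`** (Kirby 2010 (QMEC), Lemma 1.3; Haykazyan 2016,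
Prop. 4: `cl_H(X) = cl_{H'}(X)` for `H` closed in `H'`): if `φ : R → K` is an embedding of
exponential rings with `ecl`-closed image then `φ '' ecl C = ecl (φ '' C)`.
[cite: Kirby2010QMEC, Lemma 1.3] -/
theorem image_ecl_of_closedEmb (φ : ExponentialRingHom R K) (hφ : ecl (Set.range φ) = Set.range φ)
    (C : Set R) : φ '' ecl C = ecl (φ '' C) := by
  have e1 : (⇑φ : R → K) = Subtype.val ∘ ⇑(equivRangeOfClosedEmb φ hφ) := funext fun z => rfl
  rw [e1, Set.image_comp, Khovanskii.image_ecl_equiv, Khovanskii.eclSubfield.image_ecl,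
    ← Set.image_comp]

/-- A closed embedding pulls back an embedding of exponential rings landing in its image.
[folklore] -/
theorem exists_lift_of_closedEmb (φ : ExponentialRingHom R K) (hφ : ecl (Set.range φ) = Set.range φ)
    {T : Type*} [Field T] [ExponentialRing T] (ψ' : ExponentialRingHom T K)
    (hψ' : Set.range ψ' ⊆ Set.range φ) :
    ∃ ψ : ExponentialRingHom T R, ∀ t, φ (ψ t) = ψ' t := by
  have hmem : ∀ t, ψ' t ∈ Khovanskii.eclSubfield (Set.range φ) := fun t => by
    change ψ' t ∈ ecl (Set.range φ)
    rw [hφ]; exact hψ' ⟨t, rfl⟩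
  let ψ₀ : ExponentialRingHom T (Khovanskii.eclSubfield (Set.range φ)) :=
    { toRingHom := ψ'.toRingHom.codRestrict _ hmem
      map_exp' := fun t => Subtype.ext (by
        change (ψ' (ExponentialRing.exp t) : K) = ExponentialRing.exp (ψ' t : K)
        exact ψ'.map_exp t) }
  let e := equivRangeOfClosedEmb φ hφ
  refine ⟨e.symm.toExponentialRingHom.comp ψ₀, fun t => ?_⟩
  change φ (e.symm (ψ₀ t)) = ψ' t
  have : ((e (e.symm (ψ₀ t)) : Khovanskii.eclSubfield (Set.range φ)) : K) = ψ' t := by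
    rw [ExponentialRingEquiv.apply_symm_apply]; rfl
  rwa [coe_equivRangeOfClosedEmb_apply] at this

/-- **The relation symbols of `Language.eclIso` are invariant under closed embeddings**: for a
closed embedding `φ : R → K` and a tuple `u` from `R`, `R_{(T,t̄)}(u)` holds in `R` iff
`R_{(T,t̄)}(φ u)` holds in `K` — both say `(ecl(u), u) ≅ (T, t̄)`, and `φ` restricts to an
isomorphism `ecl^R(u) ≅ ecl^K(φ u)`. [cite: Kirby2010QMEC, Lemma 1.3] -/
theorem relMap_comp_iff_of_closedEmb (φ : ExponentialRingHom R K)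
    (hφ : ecl (Set.range φ) = Set.range φ) {k : ℕ} (T : PointedEField k) (u : Fin k → R) :
    Structure.RelMap (L := Language.eclIso) T u ↔
      Structure.RelMap (L := Language.eclIso) T (⇑φ ∘ u) := by
  have hφinj : Function.Injective φ := φ.toRingHom.injective
  rw [Language.eclIso.relMap_iff, Language.eclIso.relMap_iff]
  constructor
  · rintro ⟨ψ, hψ, hψt⟩
    refine ⟨φ.comp ψ, ?_, ?_⟩
    · change Set.range (⇑φ ∘ ⇑ψ) = _
      rw [Set.range_comp, hψ, image_ecl_of_closedEmb φ hφ, ← Set.range_comp]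
    · change (⇑φ ∘ ⇑ψ) ∘ T.pt = _
      rw [Function.comp_assoc, hψt]
  · rintro ⟨ψ', hψ', hψ't⟩
    have hsub : Set.range ψ' ⊆ Set.range φ := by
      rw [hψ', Set.range_comp, ← image_ecl_of_closedEmb φ hφ]
      exact Set.image_subset_range _ _
    obtain ⟨ψ, hψ⟩ := exists_lift_of_closedEmb φ hφ ψ' hsub
    refine ⟨ψ, ?_, ?_⟩
    · apply (Set.image_injective.2 hφinj)
      rw [image_ecl_of_closedEmb φ hφ, ← Set.range_comp, ← Set.range_comp,
        show (⇑φ ∘ ⇑ψ) = ⇑ψ' from funext hψ, hψ']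
    · funext i
      apply hφinj
      rw [Function.comp_apply, hψ]
      exact congr_fun hψ't i

variable {R' : Type*} [Field R'] [ExponentialRing R'] {K' : Type*} [Field K'] [ExponentialRing K']

/-- Atomic `Language.eclIso`-formulas are evaluated on a tuple as on its image under a closed
embedding. [folklore] -/
theorem realize_iff_comp_of_closedEmb (φ : ExponentialRingHom R K)
    (hφ : ecl (Set.range φ) = Set.range φ) {α : Type*} {ψf : Language.eclIso.Formula α}
    (hψf : ψf.IsAtomic) (v : α → R) : ψf.Realize v ↔ ψf.Realize (⇑φ ∘ v) := by
  have hφinj : Function.Injective φ := φ.toRingHom.injective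
  have hv : Sum.elim (⇑φ ∘ v) (default : Fin 0 → K) = ⇑φ ∘ Sum.elim v (default : Fin 0 → R) := by
    funext s; rcases s with i | j
    · rfl
    · exact j.elim0
  change BoundedFormula.Realize ψf v default ↔ BoundedFormula.Realize ψf (⇑φ ∘ v) default
  cases hψf with
  | equal t₁ t₂ =>
    simp only [BoundedFormula.realize_bdEqual]
    rw [hv, ← realize_term_eHom, ← realize_term_eHom, hφinj.eq_iff]
  | rel T ts =>
    simp only [BoundedFormula.realize_rel]
    rw [hv]
    have e2 : (fun i => (ts i).realize (⇑φ ∘ Sum.elim v default)) =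
        ⇑φ ∘ fun i => (ts i).realize (Sum.elim v default) := by
      funext i
      simp only [Function.comp_apply, ← realize_term_eHom]
    rw [e2]
    exact relMap_comp_iff_of_closedEmb φ hφ T _

/-- **Quantifier-free `Language.eclIso`-types are invariant under closed embeddings** (Kirby
2010, Lemma 1.3 with Prop. 3.5: for `H ⊆ K`, `H' ⊆ K'` `ecl`-closed, tuples from `H`, `H'` have the
same quantifier-free type computed in `H, H'` iff computed in `K, K'`).
[cite: Kirby2010QMEC, Lemma 1.3] -/
theorem eqQFType₂_comp_iff_of_closedEmb (φ : ExponentialRingHom R K)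
    (hφ : ecl (Set.range φ) = Set.range φ) (φ' : ExponentialRingHom R' K')
    (hφ' : ecl (Set.range φ') = Set.range φ') {α : Type*} (x : α → R) (x' : α → R') :
    Language.eclIso.EqQFType₂ (⇑φ ∘ x) (⇑φ' ∘ x') ↔ Language.eclIso.EqQFType₂ x x' := by
  constructor
  · intro h ψf hψf
    rw [realize_iff_comp_of_closedEmb φ hφ hψf, realize_iff_comp_of_closedEmb φ' hφ' hψf]
    exact h ψf hψf
  · intro h ψf hψf
    rw [← realize_iff_comp_of_closedEmb φ hφ hψf, ← realize_iff_comp_of_closedEmb φ' hφ' hψf]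
    exact h ψf hψf

/-- The identity of an exponential field is a closed embedding iff… it always is: `ecl ⊤ = ⊤`.
[folklore] -/
theorem ecl_range_id : ecl (Set.range (ExponentialRingHom.id R)) = Set.range (ExponentialRingHom.id R) := by
  have : Set.range (ExponentialRingHom.id R) = Set.univ := Set.eq_univ_of_forall fun z => ⟨z, rfl⟩
  rw [this]
  exact Set.eq_univ_of_univ_subset (subset_ecl _)

/-- Compositions of closed embeddings are closed embeddings. [folklore] -/
theorem ecl_range_comp_of_closedEmb {S : Type*} [Field S] [ExponentialRing S]
    (ψ : ExponentialRingHom S R) (hψ : ecl (Set.range ψ) = Set.range ψ)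
    (φ : ExponentialRingHom R K) (hφ : ecl (Set.range φ) = Set.range φ) :
    ecl (Set.range (φ.comp ψ)) = Set.range (φ.comp ψ) := by
  change ecl (Set.range (⇑φ ∘ ⇑ψ)) = Set.range (⇑φ ∘ ⇑ψ)
  rw [Set.range_comp, ← image_ecl_of_closedEmb φ hφ, hψ]

/-- The inclusion of `ecl X` is a closed embedding. [folklore] -/
theorem ecl_range_eHom {K : Type*} [Field K] [ExponentialRing K] (X : Set K) :
    ecl (Set.range (Khovanskii.eclSubfield.eHom X)) = Set.range (Khovanskii.eclSubfield.eHom X) := by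
  have : Set.range (Khovanskii.eclSubfield.eHom X) = ecl X := by
    ext a; constructor
    · rintro ⟨b, rfl⟩; exact b.2
    · intro ha; exact ⟨⟨a, ha⟩, rfl⟩
  rw [this, Khovanskii.ecl_ecl]

end ClosedEmb

/-! ### The class of closed E-subfields of Zilber fields -/

/-- **The class of closed substructures of Zilber fields** (Bays–Kirby 2018, Def. 6.3 / Kirby
2010, axiom I.2): an `Language.eclIso`-structure-with-closure `⟨H, cl⟩` (with `H : Type`) is in
`ZilberClosedClass` iff it is the canonical structure of an exponential field `H` of
characteristic zero with `cl = ecl`, which admits an embedding of exponential rings into some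
Zilber field `K` (in `Type`) whose image is `ecl`-closed in `K`. Zilber fields themselves are
members (`zilberClosedClass_of_isZilberField`). [cite: BaysKirby2018ANT, Def. 6.3]
[cite: Kirby2010QMEC, Def. 1.1 (axiom I.2)] -/
def ZilberClosedClass : ∀ (H : Type) [Language.eclIso.Structure H], (Set H → Set H) → Prop :=
  fun H inst cl => ∃ (iF : Field H) (_ : CharZero H) (iE : ExponentialRing H),
    @Language.eclIso.instStructure H iF iE = inst ∧ cl = @ecl H iF iE ∧
    ∃ (K : Type) (iFK : Field K) (_ : CharZero K) (iEK : ExponentialRing K) (_ : IsZilberField K)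
      (φ : @ExponentialRingHom H K _ _ iE iEK),
        @ecl K iFK iEK (Set.range φ) = Set.range φ

/-- A Zilber field (in `Type`), with its canonical structure and `ecl`, is a member: the identity
is a closed embedding. [folklore] -/
theorem zilberClosedClass_of_isZilberField {K : Type} [Field K] [CharZero K] [ExponentialRing K]
    (hK : IsZilberField K) : ZilberClosedClass K ecl :=
  ⟨_, ‹_›, _, rfl, rfl, K, _, ‹_›, _, hK, ExponentialRingHom.id K, ecl_range_id⟩

/-- More generally, an exponential field of characteristic zero with a closed embedding into a
Zilber field is a member. [folklore] -/
theorem zilberClosedClass_of_closedEmb {H : Type} [Field H] [CharZero H] [ExponentialRing H]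
    {K : Type} [Field K] [CharZero K] [ExponentialRing K] (hK : IsZilberField K)
    (φ : ExponentialRingHom H K) (hφ : ecl (Set.range φ) = Set.range φ) : ZilberClosedClass H ecl :=
  ⟨_, ‹_›, _, rfl, rfl, K, _, ‹_›, _, hK, φ, hφ⟩

namespace ZilberClosedClass

/-! ### The elementary axioms -/

section Elementary

variable {H H' : Type} [Language.eclIso.Structure H] [Language.eclIso.Structure H']
  {cl : Set H → Set H} {cl' : Set H' → Set H'}

/-- Axiom (3i), pregeometry. [cite: Kirby2010, Thm. 1.1] -/
theorem isPregeometry (hH : ZilberClosedClass H cl) : IsPregeometry cl := by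
  obtain ⟨iF, _, iE, -, rfl, -⟩ := hH
  exact isPregeometry_ecl H

/-- Axiom (3i), countable closure: `φ '' ecl A = ecl (φ '' A)` is countable in the Zilber field and
`φ` is injective. [cite: BaysKirby2018ANT, Thm 9.1 (axiom 5)] -/
theorem countable_cl (hH : ZilberClosedClass H cl) (A : Set H) (hA : A.Finite) :
    (cl A).Countable := by
  obtain ⟨iF, _, iE, -, rfl, K, iFK, _, iEK, hK, φ, hφ⟩ := hH
  have h1 : (φ '' ecl A).Countable := by
    rw [image_ecl_of_closedEmb φ hφ]
    exact hK.hasCountableClosureProperty _ (hA.image _).countable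
  exact Set.countable_of_injective_of_countable_image φ.toRingHom.injective.injOn h1

/-- Axiom (3iii): the closure is determined by partial embeddings (members are exponential
fields with `ecl`; same proof as `ZilberClass.mem_cl_iff_of_isPartialEmbOn`).
[cite: Kirby2010QMEC, Def. 1.1 (axiom I.3) and Lemma 1.3] -/
theorem mem_cl_iff_of_isPartialEmbOn (hH : ZilberClosedClass H cl) (hH' : ZilberClosedClass H' cl')
    (X : Set H) (y : H) (f : H → H') (hf : IsPartialEmbOn Language.eclIso f (insert y X)) :
    y ∈ cl X ↔ f y ∈ cl' (f '' X) := by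
  obtain ⟨iF, _, iE, rfl, rfl, -⟩ := hH
  obtain ⟨iF', _, iE', rfl, rfl, -⟩ := hH'
  have hP := isPregeometry_ecl H
  have hP' := isPregeometry_ecl H'
  -- for a finite `X₀ ⊆ X` enumerated by `b`, the matched tuples `(b, y) ↦ (f b, f y)`
  have key : ∀ {n : ℕ} (b : Fin n → H), Set.range b ⊆ X →
      (y ∈ ecl (Set.range b) ↔ f y ∈ ecl (Set.range (f ∘ b))) := by
    intro n b hb
    refine mem_ecl_range_iff_of_eqQFType₂_snoc ?_
    have hmem : ∀ i, (Fin.snoc b y : Fin (n + 1) → H) i ∈ insert y X := fun i => by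
      refine Fin.lastCases ?_ (fun j => ?_) i
      · simp
      · simpa using Or.inr (hb ⟨j, rfl⟩)
    have := hf _ hmem
    have e : f ∘ (Fin.snoc b y : Fin (n + 1) → H) = Fin.snoc (f ∘ b) (f y) := by
      funext i
      refine Fin.lastCases ?_ (fun j => ?_) i <;> simp
    rwa [e] at this
  constructor
  · intro hy
    obtain ⟨X₀, hX₀X, hX₀fin, hyX₀⟩ := hP.finite_character hy
    obtain ⟨n, b, hb⟩ := hX₀fin.fin_embedding
    have hy' : y ∈ ecl (Set.range b) := by rw [hb]; exact hyX₀
    have := (key b (hb ▸ hX₀X)).1 hy'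
    refine hP'.mono ?_ this
    rw [Set.range_comp]
    exact Set.image_mono (hb ▸ hX₀X)
  · intro hy
    obtain ⟨Y₀, hY₀, hY₀fin, hyY₀⟩ := hP'.finite_character hy
    have : ∀ z : Y₀, ∃ x ∈ X, f x = z := fun z => hY₀ z.2
    choose g hgX hgf using this
    haveI : Finite Y₀ := hY₀fin.to_subtype
    obtain ⟨n, ⟨e⟩⟩ := Finite.exists_equiv_fin Y₀
    let b : Fin n → H := fun i => g (e.symm i)
    have hbX : Set.range b ⊆ X := by rintro _ ⟨i, rfl⟩; exact hgX _
    have hfb : Set.range (f ∘ b) = Y₀ := by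
      ext z
      simp only [Set.mem_range, Function.comp_apply, b]
      constructor
      · rintro ⟨i, rfl⟩; rw [hgf]; exact (e.symm i).2
      · intro hz; exact ⟨e ⟨z, hz⟩, by rw [e.symm_apply_apply, hgf]⟩
    have hy' : f y ∈ ecl (Set.range (f ∘ b)) := by rw [hfb]; exact hyY₀
    have := (key b hbX).2 hy'
    exact hP.mono hbX this

end Elementary

end ZilberClosedClass

/-! ### Axiom (1): closure under isomorphisms -/

section Transport

variable {K : Type} [Field K] [CharZero K] [ExponentialRing K]
  {K₀ : Type} [Field K₀] [CharZero K₀] [ExponentialRing K₀]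
  {H' : Type} [Language.eclIso.Structure H']

/-- **Transport of a member along a `Language.eclIso`-isomorphism** (as
`zilberClass_of_equiv_of_isZilberField`, with the closed embedding composed with the inverse of
the transported E-field isomorphism in place of the transport of Zilber's axioms).
[cite: Haykazyan2016, Definition 2] -/
theorem zilberClosedClass_of_equiv_of_closedEmb (hK₀ : IsZilberField K₀)
    (φ : ExponentialRingHom K K₀) (hφ : ecl (Set.range φ) = Set.range φ)
    (e : K ≃[Language.eclIso] H') : ZilberClosedClass H' (fun X' => e '' ecl (e ⁻¹' X')) := by
  classical
  let E : H' ≃ K := e.toEquiv.symm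
  letI iF' : Field H' := E.field
  let r : H' ≃+* K := E.ringEquiv
  have hr : ∀ y, r y = E y := fun y => rfl
  have hrs : ∀ x, r.symm x = e x := fun x => rfl
  haveI iCZ' : CharZero H' := RingHom.charZero r.toRingHom
  letI iE' : ExponentialRing H' :=
    { exp := fun y => r.symm (ExponentialRing.exp (r y))
      exp_zero := by
        change r.symm (ExponentialRing.exp (r 0)) = 1
        rw [map_zero, ExponentialRing.exp_zero, map_one]
      exp_add := fun x y => by
        change r.symm (ExponentialRing.exp (r (x + y))) =
          r.symm (ExponentialRing.exp (r x)) * r.symm (ExponentialRing.exp (r y))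
        rw [map_add, ExponentialRing.exp_add, map_mul] }
  have hexp' : ∀ y : H', ExponentialRing.exp y = r.symm (ExponentialRing.exp (r y)) := fun y => rfl
  -- the isomorphism of exponential fields `K ≃ H'`
  let eE : ExponentialRingEquiv K H' :=
    { r.symm with
      map_exp' := fun x => by
        change r.symm (ExponentialRing.exp x) = ExponentialRing.exp (r.symm x)
        rw [hexp', RingEquiv.apply_symm_apply] }
  have heE : ∀ x, eE x = e x := fun x => rfl
  have heEfun : (⇑eE : K → H') = ⇑e := funext heE
  have hEe : ∀ y, e (E y) = y := fun y => e.toEquiv.apply_symm_apply y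
  -- the new closed embedding `φ ∘ eE⁻¹ : H' → K₀`
  let φ' : ExponentialRingHom H' K₀ := φ.comp eE.symm.toExponentialRingHom
  have hrange : Set.range φ' = Set.range φ := by
    ext z
    constructor
    · rintro ⟨y, rfl⟩; exact ⟨eE.symm y, rfl⟩
    · rintro ⟨x, rfl⟩; exact ⟨eE x, by
        change φ (eE.symm (eE x)) = φ x
        rw [ExponentialRingEquiv.symm_apply_apply]⟩
  have hφ' : ecl (Set.range φ') = Set.range φ' := by rw [hrange, hφ]
  refine ⟨iF', iCZ', iE', ?_, ?_, K₀, _, ‹_›, _, hK₀, φ', hφ'⟩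
  · -- the given structure is the canonical one of the transported exponential field
    refine structure_ext (fun f v => ?_) (fun R v => ?_)
    · have hv : ⇑e ∘ (⇑E ∘ v) = v := funext fun i => hEe (v i)
      have key := e.map_fun f (⇑E ∘ v)
      rw [hv] at key
      rw [← key]
      cases f with
      | add => rfl
      | mul => rfl
      | neg => rfl
      | zero => rfl
      | one => rfl
      | exp => rfl
    · have hv : ⇑e ∘ (⇑E ∘ v) = v := funext fun i => hEe (v i)
      have key := e.map_rel R (⇑E ∘ v)
      rw [hv] at key
      rw [key, Language.eclIso.relMap_iff, Language.eclIso.relMap_iff]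
      constructor
      · rintro ⟨φ₁, hφ₁, hφ₁t⟩
        refine ⟨eE.symm.toExponentialRingHom.comp φ₁, ?_, ?_⟩
        · have hsymm : ⇑eE.symm ∘ v = ⇑E ∘ v := funext fun i => by
            apply eE.injective
            change eE (eE.symm (v i)) = eE (E (v i))
            rw [ExponentialRingEquiv.apply_symm_apply, heE, hEe]
          change Set.range (⇑eE.symm ∘ ⇑φ₁) = _
          rw [Set.range_comp, hφ₁, Khovanskii.image_ecl_equiv, ← Set.range_comp, hsymm]
        · funext i
          have hi := congr_fun hφ₁t i
          apply eE.injective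
          change eE (eE.symm (φ₁ (R.pt i))) = eE (E (v i))
          rw [ExponentialRingEquiv.apply_symm_apply, heE, hEe]
          exact hi
      · rintro ⟨φ₁, hφ₁, hφ₁t⟩
        refine ⟨eE.toExponentialRingHom.comp φ₁, ?_, ?_⟩
        · change Set.range (⇑eE ∘ ⇑φ₁) = _
          rw [Set.range_comp, hφ₁, Khovanskii.image_ecl_equiv, ← Set.range_comp, heEfun, hv]
        · funext i
          have hi := congr_fun hφ₁t i
          change eE (φ₁ (R.pt i)) = v i
          rw [show φ₁ (R.pt i) = E (v i) from hi, heE, hEe]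
  · -- the transported closure is `ecl`
    funext X'
    rw [← heEfun, Khovanskii.image_ecl_equiv, heEfun, Set.image_preimage_eq X' e.surjective]

variable {H : Type} [Language.eclIso.Structure H] {cl : Set H → Set H}

/-- **Axiom (1) for `ZilberClosedClass`**: closure under `Language.eclIso`-isomorphisms, with the
closure transported as `X' ↦ e(cl(e⁻¹ X'))`. [cite: Haykazyan2016, Definition 2] -/
theorem ZilberClosedClass.of_equiv (hH : ZilberClosedClass H cl) (e : H ≃[Language.eclIso] H') :
    ZilberClosedClass H' (fun X' => e '' cl (e ⁻¹' X')) := by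
  obtain ⟨iF, iCZ, iE, rfl, rfl, K₀, iFK, iCK, iEK, hK₀, φ, hφ⟩ := hH
  exact zilberClosedClass_of_equiv_of_closedEmb hK₀ φ hφ e

end Transport

/-! ### Axiom (3ii): closed subsets are members -/

section ClosedSubsets

variable {K : Type} [Field K] [CharZero K] [ExponentialRing K]
  {K₀ : Type} [Field K₀] [CharZero K₀] [ExponentialRing K₀]

/-- **Closed subsets of members are members** (Kirby 2010, axiom I.2; Bays–Kirby 2018, Def. 6.3):
for a closed embedding `φ : K → K₀` into a Zilber field and `X ⊆ K`, the substructure `ecl X` of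
`K` with the restricted closure is in `ZilberClosedClass`, via the closed embedding
`φ ∘ (ecl X ↪ K)`. (Compare `zilberClass_eclSubstructure`, where the same statement for
`ZilberClass` required `ecl X` to be a Zilber field.) [cite: Kirby2010QMEC, Def. 1.1 (axiom I.2)]
[cite: BaysKirby2018ANT, Def. 6.3] -/
theorem zilberClosedClass_eclSubstructure (hK₀ : IsZilberField K₀) (φ : ExponentialRingHom K K₀)
    (hφ : ecl (Set.range φ) = Set.range φ) (X : Set K) :
    ZilberClosedClass (Language.eclIso.eclSubstructure X) (restrictCl ecl (ecl X)) := by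
  let F := Khovanskii.eclSubfield X
  have hrel : ∀ {k : ℕ} (R : PointedEField k) (v : Fin k → F),
      Structure.RelMap (L := Language.eclIso) R v ↔
        Structure.RelMap (L := Language.eclIso) R (Subtype.val ∘ v) := fun R v =>
    relMap_comp_iff_of_closedEmb (Khovanskii.eclSubfield.eHom X) (ecl_range_eHom X) R v
  have hcl : ∀ Y : Set F, (Subtype.val ⁻¹' ecl (Subtype.val '' Y) : Set F) = ecl Y := fun Y => by
    ext z
    rw [Set.mem_preimage, ← Khovanskii.eclSubfield.image_ecl]
    exact ⟨fun ⟨c, hc, hcz⟩ => by rwa [← Subtype.ext hcz], fun hz => ⟨z, hz, rfl⟩⟩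
  letI iFS : Field (Language.eclIso.eclSubstructure X) := (inferInstance : Field F)
  haveI iCS : CharZero (Language.eclIso.eclSubstructure X) := (inferInstance : CharZero F)
  letI iES : ExponentialRing (Language.eclIso.eclSubstructure X) :=
    (inferInstance : ExponentialRing F)
  let ψ : ExponentialRingHom (Language.eclIso.eclSubstructure X) K :=
    Khovanskii.eclSubfield.eHom X
  have hψ : ecl (Set.range ψ) = Set.range ψ := ecl_range_eHom X
  refine ⟨iFS, iCS, iES, ?_, ?_, K₀, _, ‹_›, _, hK₀, φ.comp ψ,
    ecl_range_comp_of_closedEmb ψ hψ φ hφ⟩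
  · refine structure_ext (fun f v => ?_) (fun R v => ?_)
    · cases f <;> rfl
    · exact hrel R v
  · funext Y
    exact hcl Y

variable {H : Type} [Language.eclIso.Structure H] {cl : Set H → Set H}

/-- **Axiom (3ii) for `ZilberClosedClass`.** [cite: Kirby2010QMEC, Def. 1.1 (axiom I.2)] -/
theorem ZilberClosedClass.cl_mem (hH : ZilberClosedClass H cl) (X : Set H) :
    ∃ S : Language.eclIso.Substructure H, (S : Set H) = cl X ∧
      ZilberClosedClass S (restrictCl cl (S : Set H)) := by
  obtain ⟨iF, iCZ, iE, rfl, rfl, K₀, iFK, iCK, iEK, hK₀, φ, hφ⟩ := hH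
  exact ⟨Language.eclIso.eclSubstructure X, rfl, zilberClosedClass_eclSubstructure hK₀ φ hφ X⟩

end ClosedSubsets

/-! ### Axioms (2), (4): transfer from the ambient Zilber fields -/

section Transfer

/-- `f ∘ ![a] = ![f a]`. [folklore] -/
theorem comp_vecSingle {α β : Type*} (f : α → β) (a : α) : f ∘ ![a] = ![f a] := by
  funext i
  fin_cases i
  rfl

variable {H K H' K' : Type} [Field H] [ExponentialRing H] [Field K] [ExponentialRing K]
  [Field H'] [ExponentialRing H'] [Field K'] [ExponentialRing K']

/-- **Pushing a partial map between members forward to the ambient Zilber fields.** For closed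
embeddings `φ : H → K`, `φ' : H' → K'` and `g : H → H'`, the map `g_K = φ' ∘ g ∘ φ⁻¹` (junk off the
image of `φ`) satisfies `g_K ∘ φ = φ' ∘ g`; closed sets, images and partial embeddings correspond.
[folklore] -/
theorem exists_pushforward (φ : ExponentialRingHom H K) (hφ : ecl (Set.range φ) = Set.range φ)
    (φ' : ExponentialRingHom H' K') (hφ' : ecl (Set.range φ') = Set.range φ')
    {G : Set H} (hG : ecl G = G) {g : H → H'} (hgG : ecl (g '' G) = g '' G)
    (hg : IsPartialEmbOn Language.eclIso g G) :
    ∃ gK : K → K', (∀ h, gK (φ h) = φ' (g h)) ∧ ecl (φ '' G) = φ '' G ∧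
      gK '' (φ '' G) = φ' '' (g '' G) ∧ ecl (gK '' (φ '' G)) = gK '' (φ '' G) ∧
      IsPartialEmbOn Language.eclIso gK (φ '' G) := by
  haveI : Nonempty H := ⟨0⟩
  have hφinj : Function.Injective φ := φ.toRingHom.injective
  let gK : K → K' := fun z => φ' (g (Function.invFun φ z))
  have hgK : ∀ h, gK (φ h) = φ' (g h) := fun h => by
    show φ' (g (Function.invFun φ (φ h))) = φ' (g h)
    rw [Function.leftInverse_invFun hφinj h]
  have himg : gK '' (φ '' G) = φ' '' (g '' G) := by
    rw [Set.image_image, Set.image_image]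
    exact Set.image_congr fun h _ => hgK h
  refine ⟨gK, hgK, by rw [← image_ecl_of_closedEmb φ hφ, hG], himg, ?_, ?_⟩
  · rw [himg, ← image_ecl_of_closedEmb φ' hφ', hgG]
  · intro n u hu
    choose u₀ hu₀G hu₀ using hu
    have eu : u = ⇑φ ∘ u₀ := funext fun i => (hu₀ i).symm
    have egu : gK ∘ u = ⇑φ' ∘ (g ∘ u₀) := funext fun i => by
      rw [Function.comp_apply, ← hu₀ i, hgK]; rfl
    rw [egu, eu]
    exact (eqQFType₂_comp_iff_of_closedEmb φ hφ φ' hφ' u₀ (g ∘ u₀)).2 (hg u₀ hu₀G)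

/-- Pulling an `EqQFTypeOver₂` back from the ambient fields. [folklore] -/
theorem eqQFTypeOver₂_of_pushforward (φ : ExponentialRingHom H K) (hφ : ecl (Set.range φ) = Set.range φ)
    (φ' : ExponentialRingHom H' K') (hφ' : ecl (Set.range φ') = Set.range φ')
    {G : Set H} {g : H → H'} {gK : K → K'} (hgK : ∀ h, gK (φ h) = φ' (g h)) {n : ℕ}
    {t : Fin n → H} {t' : Fin n → H'}
    (h : Language.eclIso.EqQFTypeOver₂ (φ '' G) gK (⇑φ ∘ t) (⇑φ' ∘ t')) :
    Language.eclIso.EqQFTypeOver₂ G g t t' := by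
  intro m σ hσ
  have key := h (⇑φ ∘ σ) fun i => Set.mem_image_of_mem φ (hσ i)
  rw [show gK ∘ (⇑φ ∘ σ) = ⇑φ' ∘ (g ∘ σ) from funext fun i => hgK (σ i), ← comp_append',
    ← comp_append'] at key
  exact (eqQFType₂_comp_iff_of_closedEmb φ hφ φ' hφ' _ _).1 key

/-- Pushing an `EqQFTypeOver₂` forward to the ambient fields. [folklore] -/
theorem eqQFTypeOver₂_pushforward (φ : ExponentialRingHom H K) (hφ : ecl (Set.range φ) = Set.range φ)
    (φ' : ExponentialRingHom H' K') (hφ' : ecl (Set.range φ') = Set.range φ')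
    {G : Set H} {g : H → H'} {gK : K → K'} (hgK : ∀ h, gK (φ h) = φ' (g h)) {n : ℕ}
    {t : Fin n → H} {t' : Fin n → H'} (h : Language.eclIso.EqQFTypeOver₂ G g t t') :
    Language.eclIso.EqQFTypeOver₂ (φ '' G) gK (⇑φ ∘ t) (⇑φ' ∘ t') := by
  intro m σK hσK
  choose σ hσG hσ using hσK
  have eσ : σK = ⇑φ ∘ σ := funext fun i => (hσ i).symm
  have key := (eqQFType₂_comp_iff_of_closedEmb φ hφ φ' hφ' _ _).2 (h σ hσG)
  rw [comp_append', comp_append'] at key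
  rw [eσ, show gK ∘ (⇑φ ∘ σ) = ⇑φ' ∘ (g ∘ σ) from funext fun i => hgK (σ i)]
  exact key

end Transfer

namespace ZilberClosedClass

section Homogeneity

variable
  (h₂ : ∀ {K K' : Type} [Field K] [CharZero K] [ExponentialRing K] [Field K'] [CharZero K']
    [ExponentialRing K'], IsZilberField K → IsZilberField K' →
      ∃ φ : ExponentialRingHom (Khovanskii.eclSubfield (∅ : Set K)) K', Set.range φ = ecl ∅)
  (h₄₃ : ∀ {K K' : Type} [Field K] [CharZero K] [ExponentialRing K] [Field K'] [CharZero K']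
    [ExponentialRing K'], IsZilberField K → IsZilberField K' →
      ∀ (G : Set K) (g : K → K'), G.Countable → ecl G = G → ecl (g '' G) = g '' G →
        IsPartialEmbOn Language.eclIso g G → ∀ ⦃x : K⦄ ⦃x' : K'⦄, x ∉ ecl G → x' ∉ ecl (g '' G) →
          Language.eclIso.EqQFTypeOver₂ G g ![x] ![x'])
  (h₄₄ : ∀ {K K' : Type} [Field K] [CharZero K] [ExponentialRing K] [Field K'] [CharZero K']
    [ExponentialRing K'], IsZilberField K → IsZilberField K' →
      ∀ (G : Set K) (g : K → K'), G.Countable → ecl G = G → ecl (g '' G) = g '' G →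
        ∀ ⦃n : ℕ⦄ (x : Fin n → K) (x' : Fin n → K'), Language.eclIso.EqQFTypeOver₂ G g x x' →
          ∀ ⦃y : K⦄, y ∈ ecl (G ∪ Set.range x) →
            ∃ y' : K', Language.eclIso.EqQFTypeOver₂ G g (Fin.snoc x y : Fin (n + 1) → K)
              (Fin.snoc x' y'))

variable {H H' : Type} [Language.eclIso.Structure H] [Language.eclIso.Structure H']
  {cl : Set H → Set H} {cl' : Set H' → Set H'}

include h₂ in
/-- **Axiom (2) for `ZilberClosedClass`** from the isomorphism of the `ecl(∅)`'s of the ambient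
Zilber fields (`ZilberClass.eqQFType₂_elim0_of`), transferred along the closed embeddings.
[cite: Kirby2013FPEF, Cor. 6.10] -/
theorem eqQFType₂_elim0_of (hH : ZilberClosedClass H cl) (hH' : ZilberClosedClass H' cl') :
    Language.eclIso.EqQFType₂ (Fin.elim0 : Fin 0 → H) (Fin.elim0 : Fin 0 → H') := by
  obtain ⟨iF, iCZ, iE, rfl, rfl, K₀, iFK, iCK, iEK, hK₀, φ, hφ⟩ := hH
  obtain ⟨iF', iCZ', iE', rfl, rfl, K₀', iFK', iCK', iEK', hK₀', φ', hφ'⟩ := hH'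
  have key : Language.eclIso.EqQFType₂ (Fin.elim0 : Fin 0 → K₀) (Fin.elim0 : Fin 0 → K₀') :=
    ZilberClass.eqQFType₂_elim0_of h₂ (zilberClass_ecl hK₀) (zilberClass_ecl hK₀')
  refine (eqQFType₂_comp_iff_of_closedEmb φ hφ φ' hφ' _ _).1 ?_
  rwa [show (⇑φ ∘ (Fin.elim0 : Fin 0 → H)) = Fin.elim0 from funext fun i => i.elim0,
    show (⇑φ' ∘ (Fin.elim0 : Fin 0 → H')) = Fin.elim0 from funext fun i => i.elim0]

include h₄₃ in
/-- The `ZilberClass`-member form of `h₄₃` (members of `ZilberClass` are Zilber fields). [folklore] -/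
theorem h₄₃_zilberClass {H H' : Type} [Language.eclIso.Structure H] [Language.eclIso.Structure H']
    {cl : Set H → Set H} {cl' : Set H' → Set H'} (hH : ZilberClass H cl) (hH' : ZilberClass H' cl')
    (G : Set H) (g : H → H') (hGc : G.Countable) (hG : cl G = G) (hgG : cl' (g '' G) = g '' G)
    (hg : IsPartialEmbOn Language.eclIso g G) ⦃x : H⦄ ⦃x' : H'⦄ (hx : x ∉ cl G)
    (hx' : x' ∉ cl' (g '' G)) : Language.eclIso.EqQFTypeOver₂ G g ![x] ![x'] := by
  obtain ⟨iF, iCZ, iE, hZ, rfl, rfl⟩ := hH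
  obtain ⟨iF', iCZ', iE', hZ', rfl, rfl⟩ := hH'
  exact h₄₃ hZ hZ' G g hGc hG hgG hg hx hx'

include h₂ h₄₃ in
/-- **Axiom (4i) over `∅` for `ZilberClosedClass`**: points outside `ecl(∅)` in two members have
the same quantifier-free type — in the ambient Zilber fields this is
`ZilberClass.eqQFType₂_of_notMem_cl_empty_of`, and `ecl^H(∅) ↦ ecl^K(∅)` under the closed
embedding. [cite: Haykazyan2016, Definition 2] -/
theorem eqQFType₂_of_notMem_cl_empty (hH : ZilberClosedClass H cl) (hH' : ZilberClosedClass H' cl')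
    ⦃x : H⦄ ⦃x' : H'⦄ (hx : x ∉ cl ∅) (hx' : x' ∉ cl' ∅) :
    Language.eclIso.EqQFType₂ ![x] ![x'] := by
  obtain ⟨iF, iCZ, iE, rfl, rfl, K₀, iFK, iCK, iEK, hK₀, φ, hφ⟩ := hH
  obtain ⟨iF', iCZ', iE', rfl, rfl, K₀', iFK', iCK', iEK', hK₀', φ', hφ'⟩ := hH'
  have hφinj : Function.Injective φ := φ.toRingHom.injective
  have hφ'inj : Function.Injective φ' := φ'.toRingHom.injective
  have hxK : φ x ∉ ecl (∅ : Set K₀) := fun h => by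
    rw [← Set.image_empty φ, ← image_ecl_of_closedEmb φ hφ] at h
    obtain ⟨z, hz, hzx⟩ := h
    exact hx (hφinj hzx ▸ hz)
  have hxK' : φ' x' ∉ ecl (∅ : Set K₀') := fun h => by
    rw [← Set.image_empty φ', ← image_ecl_of_closedEmb φ' hφ'] at h
    obtain ⟨z, hz, hzx⟩ := h
    exact hx' (hφ'inj hzx ▸ hz)
  have key : Language.eclIso.EqQFType₂ ![φ x] ![φ' x'] :=
    ZilberClass.eqQFType₂_of_notMem_cl_empty_of h₂ (fun hH hH' => h₄₃_zilberClass h₄₃ hH hH')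
      (zilberClass_ecl hK₀) (zilberClass_ecl hK₀') hxK hxK'
  rw [← comp_vecSingle, ← comp_vecSingle] at key
  exact (eqQFType₂_comp_iff_of_closedEmb φ hφ φ' hφ' _ _).1 key

include h₄₃ in
/-- **Axiom (4i) over countable closed sets for `ZilberClosedClass`**, transferred from the ambient
Zilber fields along the closed embeddings (`exists_pushforward`).
[cite: BaysKirby2013Excellence, Prop. 5] -/
theorem eqQFTypeOver₂_of_notMem_of_closed (hH : ZilberClosedClass H cl)
    (hH' : ZilberClosedClass H' cl') (G : Set H) (g : H → H') (hGc : G.Countable) (hG : cl G = G)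
    (hgG : cl' (g '' G) = g '' G) (hg : IsPartialEmbOn Language.eclIso g G) ⦃x : H⦄ ⦃x' : H'⦄
    (hx : x ∉ cl G) (hx' : x' ∉ cl' (g '' G)) : Language.eclIso.EqQFTypeOver₂ G g ![x] ![x'] := by
  obtain ⟨iF, iCZ, iE, rfl, rfl, K₀, iFK, iCK, iEK, hK₀, φ, hφ⟩ := hH
  obtain ⟨iF', iCZ', iE', rfl, rfl, K₀', iFK', iCK', iEK', hK₀', φ', hφ'⟩ := hH'
  have hφinj : Function.Injective φ := φ.toRingHom.injective
  have hφ'inj : Function.Injective φ' := φ'.toRingHom.injective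
  obtain ⟨gK, hgK, hGK, himg, himgcl, hgKemb⟩ := exists_pushforward φ hφ φ' hφ' hG hgG hg
  have hxK : φ x ∉ ecl (φ '' G) := fun h => by
    rw [← image_ecl_of_closedEmb φ hφ, hG] at h
    obtain ⟨z, hz, hzx⟩ := h
    exact hx (hG.symm ▸ hφinj hzx ▸ hz)
  have hxK' : φ' x' ∉ ecl (gK '' (φ '' G)) := fun h => by
    rw [himg, ← image_ecl_of_closedEmb φ' hφ', hgG] at h
    obtain ⟨z, hz, hzx⟩ := h
    exact hx' (hgG.symm ▸ hφ'inj hzx ▸ hz)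
  have key := h₄₃ hK₀ hK₀' (φ '' G) gK (hGc.image _) hGK himgcl hgKemb hxK hxK'
  rw [← comp_vecSingle, ← comp_vecSingle] at key
  exact eqQFTypeOver₂_of_pushforward φ hφ φ' hφ' hgK key

include h₄₄ in
/-- **Axiom (4ii) over countable closed sets for `ZilberClosedClass`**, transferred from the
ambient Zilber fields: the partner found in `K'` lies in the closure of the image of `H'`, hence in
it (finite character of `ecl` and `mem_ecl_range_iff_of_eqQFType₂_snoc`).
[cite: BaysKirby2013Excellence, Prop. 5] -/
theorem exists_eqQFTypeOver₂_snoc_of_closed (hH : ZilberClosedClass H cl)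
    (hH' : ZilberClosedClass H' cl') (G : Set H) (g : H → H') (hGc : G.Countable) (hG : cl G = G)
    (hgG : cl' (g '' G) = g '' G) ⦃n : ℕ⦄ (x : Fin n → H) (x' : Fin n → H')
    (hxx' : Language.eclIso.EqQFTypeOver₂ G g x x') ⦃y : H⦄ (hy : y ∈ cl (G ∪ Set.range x)) :
    ∃ y' : H', Language.eclIso.EqQFTypeOver₂ G g (Fin.snoc x y : Fin (n + 1) → H)
      (Fin.snoc x' y') := by
  obtain ⟨iF, iCZ, iE, rfl, rfl, K₀, iFK, iCK, iEK, hK₀, φ, hφ⟩ := hH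
  obtain ⟨iF', iCZ', iE', rfl, rfl, K₀', iFK', iCK', iEK', hK₀', φ', hφ'⟩ := hH'
  have hP := isPregeometry_ecl H
  have hg : IsPartialEmbOn Language.eclIso g G := hxx'.isPartialEmbOn
  obtain ⟨gK, hgK, hGK, himg, himgcl, -⟩ := exists_pushforward φ hφ φ' hφ' hG hgG hg
  have hK := eqQFTypeOver₂_pushforward φ hφ φ' hφ' hgK hxx'
  -- `φ y ∈ ecl (φ G ∪ φ x)`
  have hyK : φ y ∈ ecl (φ '' G ∪ Set.range (⇑φ ∘ x)) := by
    rw [Set.range_comp, ← Set.image_union, ← image_ecl_of_closedEmb φ hφ]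
    exact Set.mem_image_of_mem φ hy
  obtain ⟨yK, hyK'⟩ := h₄₄ hK₀ hK₀' (φ '' G) gK (hGc.image _) hGK himgcl (⇑φ ∘ x) (⇑φ' ∘ x') hK hyK
  -- `yK` lies in the image of `φ'`: finite support of `y` inside `G`
  obtain ⟨A₀, hA₀, hA₀fin, hyA₀⟩ := hP.finite_character hy
  obtain ⟨m, σ, hσ⟩ := (hA₀fin.inter_of_left G).fin_embedding
  have hσG : ∀ i, σ i ∈ G := fun i => ((hσ ▸ Set.mem_range_self i : σ i ∈ A₀ ∩ G)).2
  have hyσ : y ∈ ecl (Set.range (Fin.append (σ : Fin m → H) x)) := by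
    refine hP.mono ?_ hyA₀
    intro c hc
    rw [range_append]
    rcases hA₀ hc with hcG | hcx
    · exact Or.inl (hσ ▸ ⟨hc, hcG⟩ : c ∈ Set.range σ)
    · exact Or.inr hcx
  have key := hyK' (⇑φ ∘ σ) fun i => Set.mem_image_of_mem φ (hσG i)
  rw [Fin.append_snoc, Fin.append_snoc] at key
  have hyK₁ : φ y ∈ ecl (Set.range (Fin.append (⇑φ ∘ σ) (⇑φ ∘ x))) := by
    rw [← comp_append', Set.range_comp, ← image_ecl_of_closedEmb φ hφ]
    exact Set.mem_image_of_mem φ hyσ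
  have hyK₂ := (mem_ecl_range_iff_of_eqQFType₂_snoc key).1 hyK₁
  have hsub : Set.range (Fin.append (gK ∘ (⇑φ ∘ σ)) (⇑φ' ∘ x')) ⊆ Set.range φ' := by
    rw [range_append]
    rintro z (⟨i, rfl⟩ | ⟨i, rfl⟩)
    · exact ⟨g (σ i), (hgK (σ i)).symm⟩
    · exact ⟨x' i, rfl⟩
  have hyK₃ : yK ∈ Set.range φ' := by
    rw [← hφ']
    exact ecl_subset_ecl_of_subset (hsub.trans (subset_ecl _)) hyK₂
  obtain ⟨y', rfl⟩ := hyK₃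
  refine ⟨y', eqQFTypeOver₂_of_pushforward φ hφ φ' hφ' hgK ?_⟩
  rwa [Fin.comp_snoc, Fin.comp_snoc]

end Homogeneity

/-! ### Assembly -/

/-- **The class of closed E-subfields of Zilber fields is a quasiminimal pregeometry class**
(Haykazyan's Def. 2), granted, for Zilber fields `K, K'` (in `Type`): `h₂` — the `ecl(∅)`'s are
isomorphic exponential fields (Kirby 2013 FPEF, Cor. 6.10); `h₄₃`, `h₄₄` — uniqueness of the
generic type and `ℵ₀`-homogeneity over countable `ecl`-closed subsets, across `K` and `K'`
(Bays–Kirby 2013, Prop. 5; Kirby 2010, Thm 2.1, Prop. 3.5; Bays–Kirby 2018, Thm 6.9). All other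
clauses are proved (closure under isomorphism, pregeometry and countable closure, closed subsets
are members, closure determined by partial embeddings, homogeneity over `∅`).
[cite: Haykazyan2016, Definition 2] [cite: BaysKirby2013Excellence, Props 4–5] -/
theorem isQuasiminimalPregeometryClass_of
    (h₂ : ∀ {K K' : Type} [Field K] [CharZero K] [ExponentialRing K] [Field K'] [CharZero K']
      [ExponentialRing K'], IsZilberField K → IsZilberField K' →
        ∃ φ : ExponentialRingHom (Khovanskii.eclSubfield (∅ : Set K)) K', Set.range φ = ecl ∅)
    (h₄₃ : ∀ {K K' : Type} [Field K] [CharZero K] [ExponentialRing K] [Field K'] [CharZero K']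
      [ExponentialRing K'], IsZilberField K → IsZilberField K' →
        ∀ (G : Set K) (g : K → K'), G.Countable → ecl G = G → ecl (g '' G) = g '' G →
          IsPartialEmbOn Language.eclIso g G → ∀ ⦃x : K⦄ ⦃x' : K'⦄, x ∉ ecl G →
            x' ∉ ecl (g '' G) → Language.eclIso.EqQFTypeOver₂ G g ![x] ![x'])
    (h₄₄ : ∀ {K K' : Type} [Field K] [CharZero K] [ExponentialRing K] [Field K'] [CharZero K']
      [ExponentialRing K'], IsZilberField K → IsZilberField K' →
        ∀ (G : Set K) (g : K → K'), G.Countable → ecl G = G → ecl (g '' G) = g '' G →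
          ∀ ⦃n : ℕ⦄ (x : Fin n → K) (x' : Fin n → K'), Language.eclIso.EqQFTypeOver₂ G g x x' →
            ∀ ⦃y : K⦄, y ∈ ecl (G ∪ Set.range x) →
              ∃ y' : K', Language.eclIso.EqQFTypeOver₂ G g (Fin.snoc x y : Fin (n + 1) → K)
                (Fin.snoc x' y')) :
    IsQuasiminimalPregeometryClass Language.eclIso ZilberClosedClass where
  of_equiv hH e := hH.of_equiv e
  eqQFType₂_elim0 hH hH' := eqQFType₂_elim0_of h₂ hH hH'
  isPregeometry hH := hH.isPregeometry
  countable_cl hH := hH.countable_cl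
  cl_mem hH := hH.cl_mem
  mem_cl_iff_of_isPartialEmbOn hH hH' := hH.mem_cl_iff_of_isPartialEmbOn hH'
  eqQFType₂_of_notMem_cl_empty hH hH' := eqQFType₂_of_notMem_cl_empty h₂ h₄₃ hH hH'
  exists_eqQFType₂_snoc hH hH' := by
    obtain ⟨iF, iCZ, iE, rfl, rfl, -⟩ := hH
    obtain ⟨iF', iCZ', iE', rfl, rfl, -⟩ := hH'
    intro n x x' hxx' y hy
    exact exists_eqQFType₂_snoc_of_mem_ecl hxx' hy
  eqQFTypeOver₂_of_notMem_of_closed hH hH' := eqQFTypeOver₂_of_notMem_of_closed h₄₃ hH hH'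
  exists_eqQFTypeOver₂_snoc_of_closed hH hH' := exists_eqQFTypeOver₂_snoc_of_closed h₄₄ hH hH'

end ZilberClosedClass

/-! ### Zilber's categoricity theorem from `ℵ₀`-homogeneity across two Zilber fields -/

/-- **Zilber's categoricity theorem, reduced to cross-field `ℵ₀`-homogeneity** (Zilber 2005,
Thm 1.1; Bays–Kirby 2018, Thm 9.1). Granted, for Zilber fields `K, K'` in `Type`: `h₂` — the
`ecl(∅)`'s are isomorphic (Kirby 2013, Cor. 6.10); `h₄₃` — uniqueness of the generic type over
isomorphic countable `ecl`-closed subsets; `h₄₄` — `ℵ₀`-homogeneity over them (Bays–Kirby 2013,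
Prop. 5 = Kirby 2010 axiom II for `ECF_{SK,CCP}`; Bays–Kirby 2018, Thm 6.9 QM4–QM5 across two
models), any two Zilber fields of the same uncountable cardinality are isomorphic exponential
fields. Proof: the class of closed E-subfields of Zilber fields is then a quasiminimal pregeometry
class (`ZilberClosedClass.isQuasiminimalPregeometryClass_of`), whose uncountable members of equal
cardinality are isomorphic (Kirby 2010, Thm 3.3 / Haykazyan 2016, Thm 16:
`IsQuasiminimalPregeometryClass.nonempty_equiv_of_mk_eq'`), and `Language.eclIso`-isomorphisms
are isomorphisms of exponential rings. [cite: Zilber2005PseudoExp, Thm 1.1]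
[cite: BaysKirby2018ANT, Thm 9.1] [cite: Kirby2010QMEC, Thm 3.3] [cite: Haykazyan2016, Theorem 16] -/
theorem zilber_categoricity_of_homogeneity
    (h₂ : ∀ {K K' : Type} [Field K] [CharZero K] [ExponentialRing K] [Field K'] [CharZero K']
      [ExponentialRing K'], IsZilberField K → IsZilberField K' →
        ∃ φ : ExponentialRingHom (Khovanskii.eclSubfield (∅ : Set K)) K', Set.range φ = ecl ∅)
    (h₄₃ : ∀ {K K' : Type} [Field K] [CharZero K] [ExponentialRing K] [Field K'] [CharZero K']
      [ExponentialRing K'], IsZilberField K → IsZilberField K' →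
        ∀ (G : Set K) (g : K → K'), G.Countable → ecl G = G → ecl (g '' G) = g '' G →
          IsPartialEmbOn Language.eclIso g G → ∀ ⦃x : K⦄ ⦃x' : K'⦄, x ∉ ecl G →
            x' ∉ ecl (g '' G) → Language.eclIso.EqQFTypeOver₂ G g ![x] ![x'])
    (h₄₄ : ∀ {K K' : Type} [Field K] [CharZero K] [ExponentialRing K] [Field K'] [CharZero K']
      [ExponentialRing K'], IsZilberField K → IsZilberField K' →
        ∀ (G : Set K) (g : K → K'), G.Countable → ecl G = G → ecl (g '' G) = g '' G →
          ∀ ⦃n : ℕ⦄ (x : Fin n → K) (x' : Fin n → K'), Language.eclIso.EqQFTypeOver₂ G g x x' →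
            ∀ ⦃y : K⦄, y ∈ ecl (G ∪ Set.range x) →
              ∃ y' : K', Language.eclIso.EqQFTypeOver₂ G g (Fin.snoc x y : Fin (n + 1) → K)
                (Fin.snoc x' y')) :
    zilber_categoricity := by
  intro K K' _ _ _ _ _ _ hK hK' hcard hunc
  haveI : Uncountable K := aleph0_lt_mk_iff.1 hunc
  have h𝒞 := ZilberClosedClass.isQuasiminimalPregeometryClass_of h₂ h₄₃ h₄₄
  obtain ⟨e⟩ := h𝒞.nonempty_equiv_of_mk_eq' (zilberClosedClass_of_isZilberField hK)
    (zilberClosedClass_of_isZilberField hK') hcard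
  exact ⟨ExponentialRingEquiv.ofEclIsoEquiv e⟩

end Literature.NumberTheory.Transcendental

end
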